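import Summits.QuantumFields.YangMills.Theorems.BalabanUVNodesN15KingModelComplexLinkBounds
import HarnessLib
/-!
# BalabanUVNodes ∕ N15 — THE KING-MODEL RUNG (PART Ϛ-f): PERTURBATION IN THE LINK FIELD ON THE COMPLEX WINDOW — the second resolvent identity `G_{U,V} − G_{U′,V′} = G_{U,V}·T_{U−U′,V−V′}·G_{U′,V′}`,
# the sandwich bound `‖(G·T_δ·G′)_{xy}‖ ≤ cΣ_b(K(x,b₋)‖δU_b‖K(b₊,y) + K(x,b₊)‖δV_b‖K(b₋,y))` against King's SHIFTED kernel `K`, Lipschitz ∕ first-order ∕ derivative bounds uniform in the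
# volume, and print's «analytic extension = the unitary operator + a small perturbation» with the explicit constant `2(d+1)c·ε∕(m²−2(d+1)cε)²`
# (Track A, DAG node N15 = NE2; FAN-OUT v1.1 §N15 s3 «KING-MODEL RUNG … + what the curved case adds»; count-neutral)
HONEST FRAMING.  Count-neutral (cell `pub-ymgap`, seat `pub-ymgap-dag-n15-e` g43; `--supports stmt-QuantumFields-27247 --as helper` = K3ᴬ, KEY MAP v3).  One finite torus at fixed
spacing; King's `A = 0` model, FINE covariance layer only; nothing of Bałaban's (3.42) ∕ Thm 3.4 for `G(U)` asserted; nothing continuum ∕ ℝ⁴ ∕ OS ∕ Clay; NOT a node discharge.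
WHAT IS DECIDED.  [Balaban1985BackgroundPropagators] p.400 l.10–12: «In fact we prove quantitative statements which are more precise, describing these analytic extensions as small
perturbations of the operators depending on U only.»; (3.53) `Δ_{U′U} = Δ_U − V₁(A)`, (3.57) p.401 (the resolvent expansion in `V₁`).  In King's model, on the window of PART Ϛ-b
(`‖U(b)‖, ‖V(b)‖ ≤ 1+ε`, `2(d+1)cε < m²`; `K = (lapF K ((1+ε)c) (m²−2(d+1)cε))⁻¹` King's `A = 0` kernel at the shifted parameters, `m′² = m²−2(d+1)cε`):
* §1 `blk_cxHop_mul`, `l2_opNorm_blk_cxHop_mul_le` (blocks of `T_{δU,δV}·B`);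
* §2 ★ **`cxLapF_inv_sub_inv`** — THE SECOND RESOLVENT IDENTITY on the window: `G_{U,V} − G_{U′,V′} = G_{U,V}·T_{U−U′,V−V′}·G_{U′,V′}` (Ϛ-a linearity `cxHop_sub`; two-sided inverses from Ϛ-b);
* §3 ★★★ **`l2_opNorm_blk_inv_mul_cxHop_mul_inv_le`** — THE SANDWICH BOUND: for `(U,V)`, `(U′,V′)` in the window and ANY direction `(δU,δV)`,
  `‖(G_{U,V}·T_{δU,δV}·G_{U′,V′})_{xy}‖_{op} ≤ Σ_zK(x,z)·c·Σ_μ(‖δU(z,μ)‖K(z+e_μ,y) + ‖δV(z−e_μ,μ)‖K(z−e_μ,y))`; ★★★ **`l2_opNorm_blk_cxLapF_inv_sub_inv_le`** (LIPSCHITZ: the same with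
  `δ = (U−U′, V−V′)` bounds `‖(G_{U,V} − G_{U′,V′})_{xy}‖`), ★★ `l2_opNorm_blk_cxLapF_inv_sub_inv_le'` (bond-symmetric form `cΣ_{(z,μ)}(‖δU‖K(x,z)K(z+e_μ,y) + ‖δV‖K(x,z+e_μ)K(z,y))`);
* §4 ★★ **`l2_opNorm_blk_inv_mul_cxHop_mul_inv_le_of_sup`**: `sup_b‖δU_b‖, ‖δV_b‖ ≤ δ ⟹ ‖(G·T_δ·G′)_{xy}‖ ≤ 2(d+1)c·δ∕m′⁴` (each `K ≤ 1∕m′²`, each row sum `= 1∕m′²`) — in particular the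
  value `G·T_δ·G` of the Fréchet derivative of PART Ϛ-e obeys a CAUCHY-FREE bound, uniform on the window, the volume and the fibre; ★★ **`l2_opNorm_blk_cxLapF_inv_sub_inv_le_of_sup`**
  (Lipschitz in the sup distance with constant `2(d+1)c∕m′⁴`); ★★★ **`l2_opNorm_blk_cxLapF_inv_sub_unitary_le`** — PRINT's SENTENCE IN THE MODEL: for a unitary `U₀` and any two-sided
  field with `‖U(b)−U₀(b)‖, ‖V(b)−U₀(b)^*‖ ≤ ε` on all bonds (`2(d+1)cε < m²`), `‖(G_{U,V} − G_{U₀})_{xy}‖_{op} ≤ 2(d+1)c·ε∕(m²−2(d+1)cε)²` for all `x, y`, where `G_{U₀} = (−cΔ_{U₀}+m²)⁻¹`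
  is PART Ͱ's unitary covariance: the analytic extension is the unitary operator plus a perturbation of FIRST ORDER in the size of the complex neighbourhood, uniformly in everything else.
PRIOR TREE ART (by name): Ϛ-a (`cxHop`, `cxLapF`, `blk_cxHop`, `cxHop_sub`, `cxLapF_sub_cxLapF`, `cxLapF_adjoint`), Ϛ-b (`cxLapF_mul_inv`, `cxLapF_inv_mul`, `l2_opNorm_blk_cxLapF_inv_le`,
`shifted_mass_pos`, `shifted_weight_nonneg`, `unitary_mem_window`), Ϛ-c (the shifted mass bounds), Ϛ-d's pattern `norm_le_of_near_unitary` (re-proved inline, Ϛ-d not imported),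
Ͱ-b (`lapF_inv_entry_nonneg`), Ͱ-g (`blk_mul'`, `blk_sub'` — the unitary-field version of this file), `…TorusPlaneWaves` (`abs_lapF_inv_le_diag`, `lapF_inv_diag_le_inv_mass`), Ϟ-s
(`sum_lapF_inv_eq_inv_mass`), Ν-a (`lapF_inv_comm`).  Dedup (rg at filing): basename 0 files; needles `cxLapF_inv_sub_inv|blk_cxHop_mul|inv_mul_cxHop_mul_inv|cxLapF_inv_sub_unitary` 0
tree files.  Locators: [Balaban1985BackgroundPropagators] p.400 l.10–12, (3.53) p.400, (3.57) p.401, Thm 3.4 p.400, (3.42) p.397; [King1986] (4.4) p.670, (2.17) p.653.  0 `sorry`, 0 `def`.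
-/

noncomputable section
open scoped BigOperators ComplexConjugate ComplexOrder Matrix.Norms.L2Operator
open Finset Matrix

namespace Summit.QuantumFields.YangMills.BalabanUVNodes.N15KingModelRung.Covariant

open Literature.MathematicalPhysics.QuantumFieldTheory.LatticeDiamagneticInequality (Hopping blk)
open Literature.MathematicalPhysics.QuantumFieldTheory.Balaban1983to89.B5Prop11Plancherel (Tor unitVec)
open Literature.MathematicalPhysics.QuantumFieldTheory.King1986.Torus (lapF)
open Summit.QuantumFields.YangMills.BalabanUVNodes.N15KingModelRung.TorusSpectral (sum_lapF_inv_eq_inv_mass lapF_inv_comm abs_lapF_inv_le_diag lapF_inv_diag_le_inv_mass)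

variable {d : ℕ} (K : Fin (d + 1) → ℕ) [hK : ∀ μ, NeZero (K μ)]
variable {𝕜 : Type*} [RCLike 𝕜] {n : Type*} [Fintype n] [DecidableEq n] {c m2 ε : ℝ}

/-! ## §1 Blocks of `T_{δU,δV}·B` -/

/-- THE BLOCKS OF `T_{δU,δV}·B`: `(T_{δU,δV}B)_{zy} = c·Σ_μ(δU(z,μ)·B_{z+e_μ,y} + δV(z−e_μ,μ)·B_{z−e_μ,y})`. [cite: Balaban1985BackgroundPropagators, (3.53) p.400] -/
theorem blk_cxHop_mul (c : ℝ) (δU δV : Tor K × Fin (d + 1) → Matrix n n 𝕜) (B : Matrix (Tor K × n) (Tor K × n) 𝕜) (z y : Tor K) :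
    blk (cxHop K c δU δV * B) z y
      = (c : 𝕜) • ∑ μ, (δU (z, μ) * blk B (z + unitVec K μ) y + δV (z - unitVec K μ, μ) * blk B (z - unitVec K μ) y) := by
  rw [blk_mul']
  have hw : ∀ w, blk (cxHop K c δU δV) z w * blk B w y
      = (c : 𝕜) • ∑ μ, ((if w = z + unitVec K μ then δU (z, μ) * blk B w y else 0)
          + (if w = z - unitVec K μ then δV (z - unitVec K μ, μ) * blk B w y else 0)) := by
    intro w
    rw [blk_cxHop, smul_mul_assoc, Finset.sum_mul]
    congr 1
    refine Finset.sum_congr rfl fun μ _ => ?_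
    rw [add_mul]
    congr 1 <;> split_ifs <;> simp
  simp only [hw, ← Finset.smul_sum]
  congr 1
  rw [Finset.sum_comm]
  refine Finset.sum_congr rfl fun μ _ => ?_
  rw [Finset.sum_add_distrib, Finset.sum_ite_eq' Finset.univ (z + unitVec K μ), Finset.sum_ite_eq' Finset.univ (z - unitVec K μ),
    if_pos (Finset.mem_univ _), if_pos (Finset.mem_univ _)]

/-- `‖(T_{δU,δV}B)_{zy}‖_{op} ≤ c·Σ_μ(‖δU(z,μ)‖·‖B_{z+e_μ,y}‖ + ‖δV(z−e_μ,μ)‖·‖B_{z−e_μ,y}‖)` (`c ≥ 0`). [folklore] -/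
theorem l2_opNorm_blk_cxHop_mul_le (hc : 0 ≤ c) (δU δV : Tor K × Fin (d + 1) → Matrix n n 𝕜) (B : Matrix (Tor K × n) (Tor K × n) 𝕜) (z y : Tor K) :
    ‖blk (cxHop K c δU δV * B) z y‖
      ≤ c * ∑ μ, (‖δU (z, μ)‖ * ‖blk B (z + unitVec K μ) y‖ + ‖δV (z - unitVec K μ, μ)‖ * ‖blk B (z - unitVec K μ) y‖) := by
  rw [blk_cxHop_mul, norm_smul, RCLike.norm_ofReal, abs_of_nonneg hc]
  exact mul_le_mul_of_nonneg_left ((norm_sum_le _ _).trans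
    (Finset.sum_le_sum fun μ _ => (norm_add_le _ _).trans (add_le_add (norm_mul_le _ _) (norm_mul_le _ _)))) hc

/-! ## §2 The second resolvent identity on the window -/

/-- ★ **THE SECOND RESOLVENT IDENTITY ON THE COMPLEX WINDOW**: for `(U,V)` and `(U′,V′)` both in the window,
`G_{U,V} − G_{U′,V′} = G_{U,V}·T_{U−U′,V−V′}·G_{U′,V′}` (the site weights cancel; `T` is linear in the pair). [cite: Balaban1985BackgroundPropagators, (3.53) p.400, (3.57) p.401] -/
theorem cxLapF_inv_sub_inv (hc : 0 ≤ c) (hm : 0 < m2) (hε : 0 ≤ ε) (hwin : 2 * ((d : ℝ) + 1) * c * ε < m2)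
    {U V U' V' : Tor K × Fin (d + 1) → Matrix n n 𝕜} (hU : ∀ b, ‖U b‖ ≤ 1 + ε) (hV : ∀ b, ‖V b‖ ≤ 1 + ε)
    (hU' : ∀ b, ‖U' b‖ ≤ 1 + ε) (hV' : ∀ b, ‖V' b‖ ≤ 1 + ε) :
    (cxLapF K c m2 U V)⁻¹ - (cxLapF K c m2 U' V')⁻¹
      = (cxLapF K c m2 U V)⁻¹ * cxHop K c (U - U') (V - V') * (cxLapF K c m2 U' V')⁻¹ := by
  have hdiff : cxHop K c (U - U') (V - V') = cxLapF K c m2 U' V' - cxLapF K c m2 U V := by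
    rw [cxHop_sub, cxLapF_sub_cxLapF]
  rw [hdiff, Matrix.mul_sub, Matrix.sub_mul, Matrix.mul_assoc, cxLapF_mul_inv K hc hm hε hwin hU' hV', Matrix.mul_one,
    cxLapF_inv_mul K hc hm hε hwin hU hV, Matrix.one_mul]

/-! ## §3 The sandwich bound and the Lipschitz bound -/

/-- ★★★ **THE SANDWICH BOUND**: for `(U,V)`, `(U′,V′)` in the window and ANY direction `(δU,δV)`, with `K = (lapF K ((1+ε)c) (m²−2(d+1)cε))⁻¹`,
`‖(G_{U,V}·T_{δU,δV}·G_{U′,V′})_{xy}‖_{op} ≤ Σ_zK(x,z)·c·Σ_μ(‖δU(z,μ)‖·K(z+e_μ,y) + ‖δV(z−e_μ,μ)‖·K(z−e_μ,y))` — both covariances dominated by King's shifted kernel (Ϛ-b).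
[cite: Balaban1985BackgroundPropagators, (3.57) p.401, Thm 3.4 p.400, (3.42) p.397; King1986, (4.4) p.670] -/
theorem l2_opNorm_blk_inv_mul_cxHop_mul_inv_le (hc : 0 ≤ c) (hm : 0 < m2) (hε : 0 ≤ ε) (hwin : 2 * ((d : ℝ) + 1) * c * ε < m2)
    {U V U' V' : Tor K × Fin (d + 1) → Matrix n n 𝕜} (hU : ∀ b, ‖U b‖ ≤ 1 + ε) (hV : ∀ b, ‖V b‖ ≤ 1 + ε)
    (hU' : ∀ b, ‖U' b‖ ≤ 1 + ε) (hV' : ∀ b, ‖V' b‖ ≤ 1 + ε) (δU δV : Tor K × Fin (d + 1) → Matrix n n 𝕜) (x y : Tor K) :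
    ‖blk ((cxLapF K c m2 U V)⁻¹ * cxHop K c δU δV * (cxLapF K c m2 U' V')⁻¹) x y‖
      ≤ ∑ z, (lapF K ((1 + ε) * c) (m2 - 2 * ((d : ℝ) + 1) * c * ε))⁻¹ x z
          * (c * ∑ μ, (‖δU (z, μ)‖ * (lapF K ((1 + ε) * c) (m2 - 2 * ((d : ℝ) + 1) * c * ε))⁻¹ (z + unitVec K μ) y
              + ‖δV (z - unitVec K μ, μ)‖ * (lapF K ((1 + ε) * c) (m2 - 2 * ((d : ℝ) + 1) * c * ε))⁻¹ (z - unitVec K μ) y)) := by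
  have hGnn : ∀ a b, 0 ≤ (lapF K ((1 + ε) * c) (m2 - 2 * ((d : ℝ) + 1) * c * ε))⁻¹ a b := fun a b =>
    lapF_inv_entry_nonneg K (shifted_weight_nonneg hc hε) (shifted_mass_pos hwin) a b
  rw [Matrix.mul_assoc, blk_mul']
  refine (norm_sum_le _ _).trans (Finset.sum_le_sum fun z _ => (norm_mul_le _ _).trans ?_)
  refine mul_le_mul (l2_opNorm_blk_cxLapF_inv_le K hc hm hε hwin hU hV x z) ((l2_opNorm_blk_cxHop_mul_le K hc δU δV _ z y).trans ?_)
    (norm_nonneg _) (hGnn x z)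
  refine mul_le_mul_of_nonneg_left (Finset.sum_le_sum fun μ _ => add_le_add ?_ ?_) hc
  · exact mul_le_mul_of_nonneg_left (l2_opNorm_blk_cxLapF_inv_le K hc hm hε hwin hU' hV' _ y) (norm_nonneg _)
  · exact mul_le_mul_of_nonneg_left (l2_opNorm_blk_cxLapF_inv_le K hc hm hε hwin hU' hV' _ y) (norm_nonneg _)

/-- ★★★ **THE LIPSCHITZ BOUND ON THE WINDOW**: for `(U,V)`, `(U′,V′)` in the window,
`‖(G_{U,V} − G_{U′,V′})_{xy}‖_{op} ≤ Σ_zK(x,z)·c·Σ_μ(‖(U−U′)(z,μ)‖·K(z+e_μ,y) + ‖(V−V′)(z−e_μ,μ)‖·K(z−e_μ,y))` — the two covariances differ only through the bonds where the fields differ,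
with King's shifted kernel on either side. [cite: Balaban1985BackgroundPropagators, (3.57) p.401, p.400 l.10–12; King1986, (4.4) p.670] -/
theorem l2_opNorm_blk_cxLapF_inv_sub_inv_le (hc : 0 ≤ c) (hm : 0 < m2) (hε : 0 ≤ ε) (hwin : 2 * ((d : ℝ) + 1) * c * ε < m2)
    {U V U' V' : Tor K × Fin (d + 1) → Matrix n n 𝕜} (hU : ∀ b, ‖U b‖ ≤ 1 + ε) (hV : ∀ b, ‖V b‖ ≤ 1 + ε)
    (hU' : ∀ b, ‖U' b‖ ≤ 1 + ε) (hV' : ∀ b, ‖V' b‖ ≤ 1 + ε) (x y : Tor K) :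
    ‖blk ((cxLapF K c m2 U V)⁻¹ - (cxLapF K c m2 U' V')⁻¹) x y‖
      ≤ ∑ z, (lapF K ((1 + ε) * c) (m2 - 2 * ((d : ℝ) + 1) * c * ε))⁻¹ x z
          * (c * ∑ μ, (‖U (z, μ) - U' (z, μ)‖ * (lapF K ((1 + ε) * c) (m2 - 2 * ((d : ℝ) + 1) * c * ε))⁻¹ (z + unitVec K μ) y
              + ‖V (z - unitVec K μ, μ) - V' (z - unitVec K μ, μ)‖ * (lapF K ((1 + ε) * c) (m2 - 2 * ((d : ℝ) + 1) * c * ε))⁻¹ (z - unitVec K μ) y)) := by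
  rw [cxLapF_inv_sub_inv K hc hm hε hwin hU hV hU' hV']
  exact l2_opNorm_blk_inv_mul_cxHop_mul_inv_le K hc hm hε hwin hU hV hU' hV' (U - U') (V - V') x y

/-- ★★ **THE BOND-SYMMETRIC FORM OF THE SANDWICH BOUND**: `‖(G·T_{δU,δV}·G′)_{xy}‖_{op} ≤ c·Σ_{(z,μ)}(‖δU(z,μ)‖·K(x,z)K(z+e_μ,y) + ‖δV(z,μ)‖·K(x,z+e_μ)K(z,y))` — one term per bond
and per orientation: King's shifted kernel from `x` to the bond's source times from its target to `y` weights the forward variable, and the reverse for the backward variable.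
[cite: Balaban1985BackgroundPropagators, (3.57) p.401; King1986, (4.4) p.670] -/
theorem l2_opNorm_blk_inv_mul_cxHop_mul_inv_le' (hc : 0 ≤ c) (hm : 0 < m2) (hε : 0 ≤ ε) (hwin : 2 * ((d : ℝ) + 1) * c * ε < m2)
    {U V U' V' : Tor K × Fin (d + 1) → Matrix n n 𝕜} (hU : ∀ b, ‖U b‖ ≤ 1 + ε) (hV : ∀ b, ‖V b‖ ≤ 1 + ε)
    (hU' : ∀ b, ‖U' b‖ ≤ 1 + ε) (hV' : ∀ b, ‖V' b‖ ≤ 1 + ε) (δU δV : Tor K × Fin (d + 1) → Matrix n n 𝕜) (x y : Tor K) :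
    ‖blk ((cxLapF K c m2 U V)⁻¹ * cxHop K c δU δV * (cxLapF K c m2 U' V')⁻¹) x y‖
      ≤ c * ∑ z, ∑ μ, (‖δU (z, μ)‖ * ((lapF K ((1 + ε) * c) (m2 - 2 * ((d : ℝ) + 1) * c * ε))⁻¹ x z
              * (lapF K ((1 + ε) * c) (m2 - 2 * ((d : ℝ) + 1) * c * ε))⁻¹ (z + unitVec K μ) y)
          + ‖δV (z, μ)‖ * ((lapF K ((1 + ε) * c) (m2 - 2 * ((d : ℝ) + 1) * c * ε))⁻¹ x (z + unitVec K μ)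
              * (lapF K ((1 + ε) * c) (m2 - 2 * ((d : ℝ) + 1) * c * ε))⁻¹ z y)) := by
  set G := (lapF K ((1 + ε) * c) (m2 - 2 * ((d : ℝ) + 1) * c * ε))⁻¹ with hG
  refine (l2_opNorm_blk_inv_mul_cxHop_mul_inv_le K hc hm hε hwin hU hV hU' hV' δU δV x y).trans (le_of_eq ?_)
  have hre : ∀ μ : Fin (d + 1), ∑ z, G x z * (‖δV (z - unitVec K μ, μ)‖ * G (z - unitVec K μ) y)
      = ∑ z, G x (z + unitVec K μ) * (‖δV (z, μ)‖ * G z y) := fun μ =>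
    (Fintype.sum_equiv (Equiv.addRight (unitVec K μ))
      (fun z => G x (z + unitVec K μ) * (‖δV (z, μ)‖ * G z y))
      (fun z => G x z * (‖δV (z - unitVec K μ, μ)‖ * G (z - unitVec K μ) y))
      (fun z => by simp only [Equiv.coe_addRight, add_sub_cancel_right])).symm
  calc ∑ z, G x z * (c * ∑ μ, (‖δU (z, μ)‖ * G (z + unitVec K μ) y + ‖δV (z - unitVec K μ, μ)‖ * G (z - unitVec K μ) y))
      = c * ∑ μ, (∑ z, G x z * (‖δU (z, μ)‖ * G (z + unitVec K μ) y) + ∑ z, G x z * (‖δV (z - unitVec K μ, μ)‖ * G (z - unitVec K μ) y)) := by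
        simp only [Finset.mul_sum, mul_add, Finset.sum_add_distrib]
        congr 1 <;> (rw [Finset.sum_comm]; exact Finset.sum_congr rfl fun μ _ => Finset.sum_congr rfl fun z _ => by ring)
    _ = c * ∑ z, ∑ μ, (‖δU (z, μ)‖ * (G x z * G (z + unitVec K μ) y) + ‖δV (z, μ)‖ * (G x (z + unitVec K μ) * G z y)) := by
        congr 1
        rw [Finset.sum_comm]
        refine Finset.sum_congr rfl fun μ _ => ?_
        rw [hre μ, ← Finset.sum_add_distrib]
        exact Finset.sum_congr rfl fun z _ => by ring

/-! ## §4 Sup-norm forms: first-order size, uniformly in the volume -/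

/-- The shifted kernel is bounded by the inverse shifted mass: `K(a,b) ≤ 1∕m′²`. [cite: King1986, (4.4) p.670] -/
theorem lapF_inv_shifted_le_inv_mass (hc : 0 ≤ c) (hε : 0 ≤ ε) (hwin : 2 * ((d : ℝ) + 1) * c * ε < m2) (a b : Tor K) :
    (lapF K ((1 + ε) * c) (m2 - 2 * ((d : ℝ) + 1) * c * ε))⁻¹ a b ≤ (m2 - 2 * ((d : ℝ) + 1) * c * ε)⁻¹ := by
  have hc' := shifted_weight_nonneg hc hε
  have hm' := shifted_mass_pos hwin
  refine ((le_abs_self _).trans ?_).trans (lapF_inv_diag_le_inv_mass K hc' hm' b)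
  rw [lapF_inv_comm K _ _ a b]
  exact abs_lapF_inv_le_diag K hc' hm' b a

/-- ★★ **THE SANDWICH BOUND IN SUP FORM**: if `‖δU(b)‖, ‖δV(b)‖ ≤ δ` on every bond then `‖(G_{U,V}·T_{δU,δV}·G_{U′,V′})_{xy}‖_{op} ≤ 2(d+1)c·δ∕m′⁴` (`m′² = m² − 2(d+1)cε`), uniformly in the
volume, the fibre and the fields — in particular a CAUCHY-FREE bound on the Fréchet derivative value `G·T_δ·G` of PART Ϛ-e. [cite: Balaban1985BackgroundPropagators, (3.57) p.401, p.400 l.10–12] -/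
theorem l2_opNorm_blk_inv_mul_cxHop_mul_inv_le_of_sup (hc : 0 ≤ c) (hm : 0 < m2) (hε : 0 ≤ ε) (hwin : 2 * ((d : ℝ) + 1) * c * ε < m2)
    {U V U' V' : Tor K × Fin (d + 1) → Matrix n n 𝕜} (hU : ∀ b, ‖U b‖ ≤ 1 + ε) (hV : ∀ b, ‖V b‖ ≤ 1 + ε)
    (hU' : ∀ b, ‖U' b‖ ≤ 1 + ε) (hV' : ∀ b, ‖V' b‖ ≤ 1 + ε) {δU δV : Tor K × Fin (d + 1) → Matrix n n 𝕜} {δ : ℝ}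
    (hδU : ∀ b, ‖δU b‖ ≤ δ) (hδV : ∀ b, ‖δV b‖ ≤ δ) (x y : Tor K) :
    ‖blk ((cxLapF K c m2 U V)⁻¹ * cxHop K c δU δV * (cxLapF K c m2 U' V')⁻¹) x y‖
      ≤ 2 * ((d : ℝ) + 1) * c * δ * ((m2 - 2 * ((d : ℝ) + 1) * c * ε)⁻¹ * (m2 - 2 * ((d : ℝ) + 1) * c * ε)⁻¹) := by
  set G := (lapF K ((1 + ε) * c) (m2 - 2 * ((d : ℝ) + 1) * c * ε))⁻¹ with hG
  set m2' := m2 - 2 * ((d : ℝ) + 1) * c * ε with hm2'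
  have hc' := shifted_weight_nonneg hc hε
  have hm' : 0 < m2' := shifted_mass_pos hwin
  have hGnn : ∀ a b, 0 ≤ G a b := fun a b => lapF_inv_entry_nonneg K hc' hm' a b
  have hGle : ∀ a b, G a b ≤ m2'⁻¹ := fun a b => lapF_inv_shifted_le_inv_mass K hc hε hwin a b
  have hδ0 : 0 ≤ δ := (norm_nonneg _).trans (hδU ((0 : Tor K), 0))
  refine (l2_opNorm_blk_inv_mul_cxHop_mul_inv_le K hc hm hε hwin hU hV hU' hV' δU δV x y).trans ?_
  have hinner : ∀ z, c * ∑ μ : Fin (d + 1), (‖δU (z, μ)‖ * G (z + unitVec K μ) y + ‖δV (z - unitVec K μ, μ)‖ * G (z - unitVec K μ) y)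
      ≤ c * (((d : ℝ) + 1) * (2 * δ * m2'⁻¹)) := by
    intro z
    refine mul_le_mul_of_nonneg_left ?_ hc
    calc ∑ μ : Fin (d + 1), (‖δU (z, μ)‖ * G (z + unitVec K μ) y + ‖δV (z - unitVec K μ, μ)‖ * G (z - unitVec K μ) y)
        ≤ ∑ _μ : Fin (d + 1), (δ * m2'⁻¹ + δ * m2'⁻¹) :=
          Finset.sum_le_sum fun μ _ => add_le_add (mul_le_mul (hδU _) (hGle _ _) (hGnn _ _) hδ0) (mul_le_mul (hδV _) (hGle _ _) (hGnn _ _) hδ0)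
      _ = ((d : ℝ) + 1) * (2 * δ * m2'⁻¹) := by
          rw [Finset.sum_const, Finset.card_univ, Fintype.card_fin, nsmul_eq_mul]; push_cast; ring
  calc ∑ z, G x z * (c * ∑ μ, (‖δU (z, μ)‖ * G (z + unitVec K μ) y + ‖δV (z - unitVec K μ, μ)‖ * G (z - unitVec K μ) y))
      ≤ ∑ z, G x z * (c * (((d : ℝ) + 1) * (2 * δ * m2'⁻¹))) := Finset.sum_le_sum fun z _ => mul_le_mul_of_nonneg_left (hinner z) (hGnn x z)
    _ = 2 * ((d : ℝ) + 1) * c * δ * (m2'⁻¹ * m2'⁻¹) := by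
        rw [← Finset.sum_mul, hG, sum_lapF_inv_eq_inv_mass K hc' hm' x]; ring

/-- ★★ **LIPSCHITZ IN THE SUP DISTANCE ON THE WINDOW**: `‖U(b)−U′(b)‖, ‖V(b)−V′(b)‖ ≤ δ` on all bonds ⟹ `‖(G_{U,V} − G_{U′,V′})_{xy}‖_{op} ≤ 2(d+1)c·δ∕m′⁴`.
[cite: Balaban1985BackgroundPropagators, p.400 l.10–12, (3.57) p.401; King1986, (2.17) p.653, (4.4) p.670] -/
theorem l2_opNorm_blk_cxLapF_inv_sub_inv_le_of_sup (hc : 0 ≤ c) (hm : 0 < m2) (hε : 0 ≤ ε) (hwin : 2 * ((d : ℝ) + 1) * c * ε < m2)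
    {U V U' V' : Tor K × Fin (d + 1) → Matrix n n 𝕜} (hU : ∀ b, ‖U b‖ ≤ 1 + ε) (hV : ∀ b, ‖V b‖ ≤ 1 + ε)
    (hU' : ∀ b, ‖U' b‖ ≤ 1 + ε) (hV' : ∀ b, ‖V' b‖ ≤ 1 + ε) {δ : ℝ} (hdU : ∀ b, ‖U b - U' b‖ ≤ δ) (hdV : ∀ b, ‖V b - V' b‖ ≤ δ) (x y : Tor K) :
    ‖blk ((cxLapF K c m2 U V)⁻¹ - (cxLapF K c m2 U' V')⁻¹) x y‖
      ≤ 2 * ((d : ℝ) + 1) * c * δ * ((m2 - 2 * ((d : ℝ) + 1) * c * ε)⁻¹ * (m2 - 2 * ((d : ℝ) + 1) * c * ε)⁻¹) := by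
  rw [cxLapF_inv_sub_inv K hc hm hε hwin hU hV hU' hV']
  exact l2_opNorm_blk_inv_mul_cxHop_mul_inv_le_of_sup K hc hm hε hwin hU hV hU' hV' (fun b => hdU b) (fun b => hdV b) x y

/-- ★★★ **PRINT's SENTENCE IN THE MODEL — «these analytic extensions [are] small perturbations of the operators depending on U only»**: for `c ≥ 0`, `m² > 0`, `0 ≤ ε` with
`2(d+1)cε < m²`, a unitary link field `U₀`, and ANY two-sided field with `‖U(b) − U₀(b)‖ ≤ ε`, `‖V(b) − U₀(b)^*‖ ≤ ε` on all bonds: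
`‖(G_{U,V} − G_{U₀})_{xy}‖_{op} ≤ 2(d+1)c·ε∕(m² − 2(d+1)cε)²` for all `x, y`, where `G_{U₀} = (−cΔ_{U₀}+m²)⁻¹` is PART Ͱ's unitary covariance — FIRST ORDER in the size of the complex
neighbourhood, uniformly in the volume, the fibre and the field. [cite: Balaban1985BackgroundPropagators, p.400 l.10–12, Thm 3.4 p.400, (3.57) p.401; King1986, (4.4) p.670] -/
theorem l2_opNorm_blk_cxLapF_inv_sub_unitary_le (hc : 0 ≤ c) (hm : 0 < m2) (hε : 0 ≤ ε) (hwin : 2 * ((d : ℝ) + 1) * c * ε < m2)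
    {U₀ U V : Tor K × Fin (d + 1) → Matrix n n 𝕜} (hU₀ : ∀ b, U₀ b ∈ Matrix.unitaryGroup n 𝕜)
    (hU : ∀ b, ‖U b - U₀ b‖ ≤ ε) (hV : ∀ b, ‖V b - (U₀ b)ᴴ‖ ≤ ε) (x y : Tor K) :
    ‖blk ((cxLapF K c m2 U V)⁻¹ - (covLapF K c m2 U₀)⁻¹) x y‖
      ≤ 2 * ((d : ℝ) + 1) * c * ε * ((m2 - 2 * ((d : ℝ) + 1) * c * ε)⁻¹ * (m2 - 2 * ((d : ℝ) + 1) * c * ε)⁻¹) := by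
  -- the two-sided field is in the window; the unitary pair `(U₀, U₀ᴴ)` is in the window of radius `1 + 0 ≤ 1 + ε`
  have hU1 : ∀ b, ‖U b‖ ≤ 1 + ε := fun b => by
    have h := norm_add_le (U₀ b) (U b - U₀ b)
    rw [add_sub_cancel] at h
    exact h.trans (add_le_add (l2_opNorm_of_mem_unitaryGroup_le (hU₀ b)) (hU b))
  have hV1 : ∀ b, ‖V b‖ ≤ 1 + ε := fun b => by
    have h := norm_add_le ((U₀ b)ᴴ) (V b - (U₀ b)ᴴ)
    rw [add_sub_cancel] at h
    refine h.trans (add_le_add ?_ (hV b))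
    rw [Matrix.l2_opNorm_conjTranspose]; exact l2_opNorm_of_mem_unitaryGroup_le (hU₀ b)
  have hU₀1 : ∀ b, ‖U₀ b‖ ≤ 1 + ε := fun b => ((unitary_mem_window K hU₀).1 b).trans (by linarith)
  have hU₀2 : ∀ b, ‖(U₀ b)ᴴ‖ ≤ 1 + ε := fun b => ((unitary_mem_window K hU₀).2 b).trans (by linarith)
  rw [← cxLapF_adjoint]
  exact l2_opNorm_blk_cxLapF_inv_sub_inv_le_of_sup K hc hm hε hwin hU1 hV1 hU₀1 hU₀2 hU hV x y

end Summit.QuantumFields.YangMills.BalabanUVNodes.N15KingModelRung.Covariant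

end
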